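import Summits.QuantumFields.YangMills.Theorems.BalabanUVNodesN06AtRecord11Obligations
import Literature.MathematicalPhysics.QuantumFieldTheory.Balaban1983to89.B9RWSums346Schur
import Literature.MathematicalPhysics.QuantumFieldTheory.Balaban1983to89.B9GeoLemma21KLevelV1

/-!
# BalabanUVNodes ∕ N06 ([B9], `Dag.B9_main`) — OBLIGATIONS OF THE STAGE-11 CERTIFICATE KNIT AT THE RECORD, XI-d:
# `t37`, `c38`, `t310` AND THE WHOLE SUMMATION LEAF `hsum` AT THE ALL-BLOCKS PINS (seat n06-k's `B9RWSums346Schur` ∕ `B9RWSums343to347Whole`)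

Track A of `YM-PLAN.md` (cell `pub-ymgap`, HUMAN RULING D-0062), node **N06** = [Balaban1985BackgroundPropagators] Thms 3.1–3.15; seat
`pub-ymgap-dag-n06-d` gen 2 = dag-lead N06-ASSIGNMENT v1 (P3) «THE KNIT AT THE RECORD».  Companion of `…ObligationsPins` ∕ `…Pins2` ∕ `…Pins3` (per-row lemmas at `ops : OpsY N θ₃ M⋆`).

THE POINT (INTERFACE-2∕2b on the bus, resolved by seat n06-k's all-blocks pins).  In the chain of record the summation leaf `hsum : B9.RWSumsYieldIneqs geo9Y bg9Y E37 E310 Gp GA`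
(«convergence of (3.90) ∕ (3.107) at U ⇒ (3.42)–(3.47) for G′(U) ∕ G(U)», pp. 410, 416) was supplied at the pins `E37 = W38OfOps … (Conv342 …)`, `E310 = W310OfOps … (Conv3107 …)`
only in its (3.42) block; the (3.46), (3.47), (3.43)–(3.45) blocks stayed DISPLAYED (`hrest`, `hrestA`) — under those pins they are not consequences of convergence.  Seat
n06-k's ALL-BLOCKS pins put the typed conclusion of Theorems 3.1 ∕ 3.3 INTO the convergence predicate (`E37AllOfOps (W38OfOps …) … Gp B₁ δ₁ B(·) B′(·) B′(·,·)`,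
`W310OfOps … (ConvAll3107 … GA B₁ δ₁ …)`; Cor. 3.8 does not read the predicate, `cor38Printed_E37AllOfOps_iff`), so that `hsum` is a PROJECTION (`rwSumsYieldIneqs_allPins`),
and PROVE the leaves `t37` ∕ `t310` at those pins (`thm37Printed_allPin_schur`, `thm310Printed_allPin_schur`): the (3.42) majorants at U give (3.47)₀₋₃ (scale transfer + [4]
Lemma 2.1, `B9Ineq347AllEntries`) and (3.46)₀,₁,₂ (Schur test over the block majorants, G′ symmetric, (∇G′)ᵀ = G′∇*), from CO-READINGS of the kernel family by the letters
(`CoRealizes`, `GlobReads`, `L2Reads`), the member facts `Facts347` ((2.60) at α, (2.61) at 1−α, the size condition, L ≦ L₀, η > 0 — displayed, for M ≧ M_g) and the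
residual (3.43)–(3.45) + (3.46)₃,₄,₅ under the provisos (displayed, cell GAPS G-B9-07 — the H^α block is G-B9-02's).

WHAT THIS MODULE DOES (kernel bookkeeping; 0 `def`, 0 `sorry`, standard axioms; COUNT-NEUTRAL, `--supports` K1 `StabilityBAtRecordR11e`), at `I := MemberY`, `geo9Y`,
`bg9Y (M_N ℂ) SU(N)`, `c35Y` (`0 < c35` by `c35Y_pos`; `d` symmetric, `d ≥ 0`, `Lʲη > 0` by n06-i's ∕ dag-n03-b's geometry lemmas; `0 ≤ const37 …` by `const37_nonneg`):
* `t37_of_allPin` — `B9.Thm37Printed c35Y geo9Y (bg9Y …) (fun x => (ops x).E37)` at the pin `(ops x).E37 = E37AllOfOps (W38OfOps …) …` from n06-c's walk-pin inputs (as in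
  sequel II) + the Schur ∕ (3.47) readings of `(ops x).Gp`.
* `c38_of_allPin` — `B9.Cor38Printed c35Y geo9Y (bg9Y …) (fun x => (ops x).E37)` at the same pin from n06-c's `cor38Printed_of_local342` (Cor. 3.8 does not read the predicate).
* `t310_of_allPin` — `B9.Thm310Printed c35Y geo9Y (bg9Y …) (fun x => (ops x).E310)` at the pin `(ops x).E310 = W310OfOps … (ConvAll3107 … (ops x).GA …)` from n06-k's inputs (as in
  `t310_of_pin`) + the Schur ∕ (3.47) readings of `(ops x).GA`.
* `hsum_of_allPins` — `B9.RWSumsYieldIneqs geo9Y (bg9Y …) (fun x => (ops x).E37) (fun x => (ops x).E310) (fun x => (ops x).Gp) (fun x => (ops x).GA)` from the two pins ALONE.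

HONEST FRAMING.  Kernel bookkeeping at pinned readings over displayed hypothesis schemas of printed ∕ located shape; nothing of [B9] is proved for Bałaban's operators; N06 is
NOT discharged.  One finite four-torus programme at fixed `ε` — NOT ℝ⁴, NOT OS, NOT a mass gap, NOT Clay.  No `def`.
-/

noncomputable section

namespace Summit.QuantumFields.YangMills.BalabanUVNodes.N06AtRecord11ObligationsPins4

open Literature.MathematicalPhysics.QuantumFieldTheory.Balaban1983to89
open Literature.MathematicalPhysics.QuantumFieldTheory.Balaban1983to89.Node00
open Literature.MathematicalPhysics.QuantumFieldTheory.Balaban1983to89.B9PinMembersKLevelV1 (MemberY geo9Y bg9Y)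
open Literature.MathematicalPhysics.QuantumFieldTheory.Balaban1983to89.B9PinGeometryKLevelV1 (c35Y c35Y_pos)
open Literature.MathematicalPhysics.QuantumFieldTheory.Balaban1983to89.B7Prop2SpecialUnitary (specialUnitaryUnits)
open Literature.MathematicalPhysics.QuantumFieldTheory.Balaban1983to89.B9Thm34Ext (toB6)
open Literature.MathematicalPhysics.QuantumFieldTheory.Balaban1983to89.B6RandomWalk (Ineq261)
open Literature.MathematicalPhysics.QuantumFieldTheory.Balaban1983to89.B9Thm37Whole (Ops Sizes StaticOK Local342 Identities const37)
open Literature.MathematicalPhysics.QuantumFieldTheory.Balaban1983to89.B9Cor38Whole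
  (WalkReading Locality W38OfOps thm37Printed_W38OfOps_of_local342 cor38Printed_of_local342)
open Literature.MathematicalPhysics.QuantumFieldTheory.Balaban1983to89.B9Thm37GlueCor36 (CoRealizes)
open Literature.MathematicalPhysics.QuantumFieldTheory.Balaban1983to89.B9Thm37Glue (IsTransposePair)
open Literature.MathematicalPhysics.QuantumFieldTheory.Balaban1983to89.B9Thm310Whole
  (Ops310 WalkReading310 Sizes310 StaticOK310 Locality310 Local342G Factors389 Identities310 W310OfOps Conv3107 thm310Printed_of_local3107)
open Literature.MathematicalPhysics.QuantumFieldTheory.Balaban1983to89.B9RWSums343to347Whole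
  (GlobReads Facts347 ConvAll3107 E37AllOfOps cor38Printed_E37AllOfOps_iff rwSumsYieldIneqs_allPins)
open Literature.MathematicalPhysics.QuantumFieldTheory.Balaban1983to89.B9RWSums346Schur (L2Reads thm310Printed_allPin_schur thm37Printed_allPin_schur)
open Literature.MathematicalPhysics.QuantumFieldTheory.Balaban1983to89.B9GeoLemma21KLevelV1 (geo9Y_dist_comm geo9Y_len_pos)
open Literature.MathematicalPhysics.QuantumFieldTheory.Balaban1983to89.B9GeoNormsKLevelV1 (geo9K_dist_nonneg)
open Summit.QuantumFields.YangMills.BalabanUVNodes.N06AtRecord11Obligations (const37_nonneg)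
open scoped Matrix.Norms.L2Operator

variable {N : ℕ} (θ₃ : Stage3Params) (Mstar : ℕ) (ops : OpsY N θ₃ Mstar)

/-! ## `t37` and `c38` at the all-blocks pin of `E37` -/

/-- ★ **`t37` AT THE ALL-BLOCKS PIN** `(ops x).E37 = E37AllOfOps (W38OfOps (𝔬 x) (rd x) (R x) (H x) C δ) (𝔬 x) (R x) (H x) C δ (ops x).Gp B₁ δ₁ B(·) B′(·) B′(·,·)` (C = `const37 …`,
δ = (1−2α)δ₀): n06-c's walk-pin inputs give Theorem 3.7 at `W38OfOps …` (`thm37Printed_W38OfOps_of_local342`), and n06-k's `thm37Printed_allPin_schur` strengthens the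
predicate to all blocks from the co-readings of `(ops x).Gp` (sup ∕ weighted ∕ L²), the symmetry of G′(U) and the transpose pair (∇_UG′(U), G′(U)∇*_U), the member facts
`Facts347` for M ≧ M_g, the constants' relations, and the residual (3.43)–(3.45) + (3.46)₃,₄,₅ under the provisos — all displayed.
[cite: Balaban1985BackgroundPropagators, Thm 3.7 p.409, Thm 3.7 ⇒ Thm 3.1 p.410, (3.42)–(3.47) pp.397–398; Balaban1984PropagatorsII, Lemma 2.1 (2.60)–(2.61) p.234] -/
theorem t37_of_allPin [∀ x : MemberY θ₃.d₆ θ₃.ℓ₆ θ₃.hd' θ₃.hL' θ₃.b₀ θ₃.b₁ Mstar, Fintype (geo9Y x).Site] [∀ x : MemberY θ₃.d₆ θ₃.ℓ₆ θ₃.hd' θ₃.hL' θ₃.b₀ θ₃.b₁ Mstar, DecidableEq (geo9Y x).Site]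
    {X Y ι : MemberY θ₃.d₆ θ₃.ℓ₆ θ₃.hd' θ₃.hL' θ₃.b₀ θ₃.b₁ Mstar → Type} [∀ x, Fintype (X x)] [∀ x, DecidableEq (X x)] [∀ x, Fintype (Y x)] [∀ x, DecidableEq (Y x)] [∀ x, Fintype (ι x)]
    (𝔬 : ∀ x, Ops (geo9Y x) (bg9Y (Matrix (Fin N) (Fin N) ℂ) (specialUnitaryUnits (Fin N)) x) (X x) (Y x) (ι x)) (rd : ∀ x, WalkReading (geo9Y x) (bg9Y (Matrix (Fin N) (Fin N) ℂ) (specialUnitaryUnits (Fin N)) x) (X x) (ι x))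
    (R : MemberY θ₃.d₆ θ₃.ℓ₆ θ₃.hd' θ₃.hL' θ₃.b₀ θ₃.b₁ Mstar → ℝ) (H : MemberY θ₃.d₆ θ₃.ℓ₆ θ₃.hd' θ₃.hL' θ₃.b₀ θ₃.b₁ Mstar → Prop) (κ : MemberY θ₃.d₆ θ₃.ℓ₆ θ₃.hd' θ₃.hL' θ₃.b₀ θ₃.b₁ Mstar → Sizes) (d : ℕ) (α ρ Nc N' Cℓ K θ₀ B₀ δ₀ a₁ M₁ ML : ℝ)
    (hα : 0 ≤ α) (hα2 : α ≤ 1 / 2) (hN : 0 ≤ Nc) (hN' : 0 ≤ N') (hCℓ : 1 ≤ Cℓ) (hK : 0 ≤ K) (hB₀ : 0 ≤ B₀) (hδ₀ : 0 ≤ δ₀) (ha₁ : 0 < a₁) (hM₁ : 0 < M₁)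
    (hst : ∀ x, StaticOK (𝔬 x) ρ Nc N' Cℓ (κ x)) (hκ : ∀ x, (κ x).Bounded K θ₀ Cℓ (geo9Y x).M)
    (h261 : ∀ x : MemberY θ₃.d₆ θ₃.ℓ₆ θ₃.hd' θ₃.hL' θ₃.b₀ θ₃.b₁ Mstar, ML ≤ (geo9Y x).M → Ineq261 d (toB6 (geo9Y x) (R x) (H x)) δ₀ α)
    (h36 : ∀ x : MemberY θ₃.d₆ θ₃.ℓ₆ θ₃.hd' θ₃.hL' θ₃.b₀ θ₃.b₁ Mstar, M₁ ≤ (geo9Y x).M → ∀ α₀ : ℝ, 0 < α₀ → c35Y * (geo9Y x).M * α₀ ≤ a₁ →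
      ∀ U : (bg9Y (Matrix (Fin N) (Fin N) ℂ) (specialUnitaryUnits (Fin N)) x).Cfg, (bg9Y (Matrix (Fin N) (Fin N) ℂ) (specialUnitaryUnits (Fin N)) x).Reg335 c35Y α₀ U → Local342 (𝔬 x) (R x) (H x) B₀ δ₀ U ∧ Identities (𝔬 x) (R x) (H x) U)
    (ev : ∀ x : MemberY θ₃.d₆ θ₃.ℓ₆ θ₃.hd' θ₃.hL' θ₃.b₀ θ₃.b₁ Mstar, (geo9Y x).Loc → X x → ℝ) (evY : ∀ x : MemberY θ₃.d₆ θ₃.ℓ₆ θ₃.hd' θ₃.hL' θ₃.b₀ θ₃.b₁ Mstar, (geo9Y x).Loc → Y x → ℝ)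
    (hco0 : ∀ x U, CoRealizes (ops x).Gp 0 U (𝔬 x).blk (𝔬 x).blk (ev x) ((𝔬 x).Gp U))
    (hco1 : ∀ x U, CoRealizes (ops x).Gp 1 U (𝔬 x).blkY (𝔬 x).blk (ev x) ((𝔬 x).D U ∘ₗ (𝔬 x).Gp U))
    (hco2 : ∀ x U, CoRealizes (ops x).Gp 2 U (𝔬 x).blk (𝔬 x).blkY (evY x) ((𝔬 x).Gp U ∘ₗ (𝔬 x).Dstar U))
    (hco3 : ∀ x U, CoRealizes (ops x).Gp 3 U (𝔬 x).blk (𝔬 x).blk (ev x) ((𝔬 x).Lap U ∘ₗ (𝔬 x).Gp U))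
    (hgl0 : ∀ x U, GlobReads (ops x).Gp 0 U (𝔬 x).blk (𝔬 x).blk (ev x) ((𝔬 x).Gp U))
    (hgl1 : ∀ x U, GlobReads (ops x).Gp 1 U (𝔬 x).blkY (𝔬 x).blk (ev x) ((𝔬 x).D U ∘ₗ (𝔬 x).Gp U))
    (hgl2 : ∀ x U, GlobReads (ops x).Gp 2 U (𝔬 x).blk (𝔬 x).blkY (evY x) ((𝔬 x).Gp U ∘ₗ (𝔬 x).Dstar U))
    (hgl3 : ∀ x U, GlobReads (ops x).Gp 3 U (𝔬 x).blk (𝔬 x).blk (ev x) ((𝔬 x).Lap U ∘ₗ (𝔬 x).Gp U))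
    (hl0 : ∀ x U, L2Reads (R := R x) (H := H x) (ops x).Gp 0 U (𝔬 x).blk (𝔬 x).blk (ev x) ((𝔬 x).Gp U))
    (hl1 : ∀ x U, L2Reads (R := R x) (H := H x) (ops x).Gp 1 U (𝔬 x).blkY (𝔬 x).blk (ev x) ((𝔬 x).D U ∘ₗ (𝔬 x).Gp U))
    (hl2 : ∀ x U, L2Reads (R := R x) (H := H x) (ops x).Gp 2 U (𝔬 x).blk (𝔬 x).blkY (evY x) ((𝔬 x).Gp U ∘ₗ (𝔬 x).Dstar U))
    (hsym : ∀ x U, IsTransposePair ((𝔬 x).Gp U) ((𝔬 x).Gp U))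
    (htr : ∀ x U, IsTransposePair ((𝔬 x).D U ∘ₗ (𝔬 x).Gp U) ((𝔬 x).Gp U ∘ₗ (𝔬 x).Dstar U))
    {dF : ℕ} {αF L₀ B₁ δ₁ Mg Mr ar : ℝ} {Bβ Bε : ℝ → ℝ} {Bεβ : ℝ → ℝ → ℝ}
    (hfacts : ∀ x : MemberY θ₃.d₆ θ₃.ℓ₆ θ₃.hd' θ₃.hL' θ₃.b₀ θ₃.b₁ Mstar, Mg ≤ (geo9Y x).M → Facts347 (geo9Y x) (R x) (H x) dF ((1 - 2 * α) * δ₀) αF L₀)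
    (hCB : (const37 d δ₀ α ρ B₀ Nc N' Cℓ K) ≤ B₁) (hCL : (const37 d δ₀ α ρ B₀ Nc N' Cℓ K) * L₀ ≤ B₁) (hδ₁ : δ₁ ≤ (1 - αF) * ((1 - 2 * α) * δ₀)) (hαF : 0 ≤ αF * ((1 - 2 * α) * δ₀))
    (hCg : (const37 d δ₀ α ρ B₀ Nc N' Cℓ K) * B6.c1 dF ((1 - 2 * α) * δ₀) (1 - αF) * L₀ ^ (4 : ℝ) ≤ B₁) (har : 0 < ar)
    (hrest : ∀ x : MemberY θ₃.d₆ θ₃.ℓ₆ θ₃.hd' θ₃.hL' θ₃.b₀ θ₃.b₁ Mstar, Mr ≤ (geo9Y x).M → ∀ α₀ : ℝ, 0 < α₀ → (geo9Y x).M * α₀ ≤ ar → ∀ U : (bg9Y (Matrix (Fin N) (Fin N) ℂ) (specialUnitaryUnits (Fin N)) x).Cfg, (bg9Y (Matrix (Fin N) (Fin N) ℂ) (specialUnitaryUnits (Fin N)) x).Reg335 c35Y α₀ U →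
      B9.Ineq343_345 (ops x).Gp Bβ Bε Bεβ δ₁ U ∧
        ∀ (n : Fin 6), 3 ≤ n.val → ∀ (lam : (geo9Y x).Loc) (h : (geo9Y x).Cut) (y y' : (geo9Y x).Site), (geo9Y x).cutIn h y →
          (geo9Y x).suppIn lam y' →
          (ops x).Gp.l2 n U lam h ≤ B₁ * B9.pref6 ((geo9Y x).len y) n * (geo9Y x).cutSup h * Real.exp (-(δ₁ * (geo9Y x).dist y y')) *
            (geo9Y x).l2Norm lam)
    (hE37 : ∀ x : MemberY θ₃.d₆ θ₃.ℓ₆ θ₃.hd' θ₃.hL' θ₃.b₀ θ₃.b₁ Mstar, (ops x).E37 = E37AllOfOps (W38OfOps (𝔬 x) (rd x) (R x) (H x) (const37 d δ₀ α ρ B₀ Nc N' Cℓ K) ((1 - 2 * α) * δ₀)) (𝔬 x) (R x) (H x) (const37 d δ₀ α ρ B₀ Nc N' Cℓ K) ((1 - 2 * α) * δ₀) (ops x).Gp B₁ δ₁ Bβ Bε Bεβ) :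
    B9.Thm37Printed c35Y geo9Y (bg9Y (Matrix (Fin N) (Fin N) ℂ) (specialUnitaryUnits (Fin N))) (fun x => (ops x).E37) := by
  have hfun : (fun x => (ops x).E37) = fun x => E37AllOfOps (W38OfOps (𝔬 x) (rd x) (R x) (H x) (const37 d δ₀ α ρ B₀ Nc N' Cℓ K) ((1 - 2 * α) * δ₀)) (𝔬 x) (R x) (H x) (const37 d δ₀ α ρ B₀ Nc N' Cℓ K) ((1 - 2 * α) * δ₀) (ops x).Gp B₁ δ₁ Bβ Bε Bεβ :=
    funext hE37
  rw [hfun]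
  have h37 := thm37Printed_W38OfOps_of_local342 𝔬 rd R H κ d α ρ Nc N' Cℓ K θ₀ B₀ δ₀ a₁ M₁ ML c35Y_pos hα hα2 hN hN' hCℓ hK hB₀ hδ₀ ha₁ hM₁ hst hκ h261 h36
  exact thm37Printed_allPin_schur (𝔴 := fun x => (W38OfOps (𝔬 x) (rd x) (R x) (H x) (const37 d δ₀ α ρ B₀ Nc N' Cℓ K) ((1 - 2 * α) * δ₀))) (fun x => (ops x).Gp) ev evY h37 hco0 hco1 hco2 hco3
    hgl0 hgl1 hgl2 hgl3 hl0 hl1 hl2 hsym htr hfacts (fun x => geo9Y_dist_comm x) (fun x => geo9K_dist_nonneg x.toKIdx) (fun x => geo9Y_len_pos x)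
    (const37_nonneg d hB₀ hN hN' hCℓ hK) hCB hCL hδ₁ hαF hCg har hrest

/-- ★ **`c38` AT THE ALL-BLOCKS PIN**: Corollary 3.8 does not read the convergence predicate (`cor38Printed_E37AllOfOps_iff`), so n06-c's `cor38Printed_of_local342` at the walk pin
`W38OfOps …` carries over to `(ops x).E37 = E37AllOfOps (W38OfOps …) …`. [cite: Balaban1985BackgroundPropagators, Cor. 3.8 (3.93)–(3.94) p.410, Cor. 3.6 p.408] -/
theorem c38_of_allPin [∀ x : MemberY θ₃.d₆ θ₃.ℓ₆ θ₃.hd' θ₃.hL' θ₃.b₀ θ₃.b₁ Mstar, Fintype (geo9Y x).Site] [∀ x : MemberY θ₃.d₆ θ₃.ℓ₆ θ₃.hd' θ₃.hL' θ₃.b₀ θ₃.b₁ Mstar, DecidableEq (geo9Y x).Site]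
    {X Y ι : MemberY θ₃.d₆ θ₃.ℓ₆ θ₃.hd' θ₃.hL' θ₃.b₀ θ₃.b₁ Mstar → Type} [∀ x, Fintype (X x)] [∀ x, DecidableEq (X x)] [∀ x, Fintype (ι x)]
    (𝔬 : ∀ x, Ops (geo9Y x) (bg9Y (Matrix (Fin N) (Fin N) ℂ) (specialUnitaryUnits (Fin N)) x) (X x) (Y x) (ι x)) (rd : ∀ x, WalkReading (geo9Y x) (bg9Y (Matrix (Fin N) (Fin N) ℂ) (specialUnitaryUnits (Fin N)) x) (X x) (ι x))
    (R : MemberY θ₃.d₆ θ₃.ℓ₆ θ₃.hd' θ₃.hL' θ₃.b₀ θ₃.b₁ Mstar → ℝ) (H : MemberY θ₃.d₆ θ₃.ℓ₆ θ₃.hd' θ₃.hL' θ₃.b₀ θ₃.b₁ Mstar → Prop) (κ : MemberY θ₃.d₆ θ₃.ℓ₆ θ₃.hd' θ₃.hL' θ₃.b₀ θ₃.b₁ Mstar → Sizes) (d : ℕ) (α ρ Nc N' Cℓ K θ₀ B₀ δ₀ a₁ M₁ ML : ℝ)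
    (hα : 0 ≤ α) (hα1 : α < 1) (hθ₀ : 0 ≤ θ₀) (hB₀ : 0 < B₀) (hδ₀ : 0 < δ₀) (ha₁ : 0 < a₁) (hM₁ : 0 < M₁)
    (hst : ∀ x, StaticOK (𝔬 x) ρ Nc N' Cℓ (κ x)) (hκ : ∀ x, (κ x).Bounded K θ₀ Cℓ (geo9Y x).M)
    (hrd : ∀ x, (rd x).OK (𝔬 x).blk) (hloc : ∀ x, Locality (𝔬 x) (rd x))
    (h261 : ∀ x : MemberY θ₃.d₆ θ₃.ℓ₆ θ₃.hd' θ₃.hL' θ₃.b₀ θ₃.b₁ Mstar, ML ≤ (geo9Y x).M → Ineq261 d (toB6 (geo9Y x) (R x) (H x)) δ₀ α)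
    (h36 : ∀ x : MemberY θ₃.d₆ θ₃.ℓ₆ θ₃.hd' θ₃.hL' θ₃.b₀ θ₃.b₁ Mstar, M₁ ≤ (geo9Y x).M → ∀ α₀ : ℝ, 0 < α₀ → c35Y * (geo9Y x).M * α₀ ≤ a₁ →
      ∀ U : (bg9Y (Matrix (Fin N) (Fin N) ℂ) (specialUnitaryUnits (Fin N)) x).Cfg, (bg9Y (Matrix (Fin N) (Fin N) ℂ) (specialUnitaryUnits (Fin N)) x).Reg335 c35Y α₀ U → Local342 (𝔬 x) (R x) (H x) B₀ δ₀ U ∧ Identities (𝔬 x) (R x) (H x) U)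
    {B₁ δ₁ : ℝ} {Bβ Bε : ℝ → ℝ} {Bεβ : ℝ → ℝ → ℝ}
    (hE37 : ∀ x : MemberY θ₃.d₆ θ₃.ℓ₆ θ₃.hd' θ₃.hL' θ₃.b₀ θ₃.b₁ Mstar, (ops x).E37 = E37AllOfOps (W38OfOps (𝔬 x) (rd x) (R x) (H x) (const37 d δ₀ α ρ B₀ Nc N' Cℓ K) ((1 - 2 * α) * δ₀)) (𝔬 x) (R x) (H x) (const37 d δ₀ α ρ B₀ Nc N' Cℓ K) ((1 - 2 * α) * δ₀) (ops x).Gp B₁ δ₁ Bβ Bε Bεβ) :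
    B9.Cor38Printed c35Y geo9Y (bg9Y (Matrix (Fin N) (Fin N) ℂ) (specialUnitaryUnits (Fin N))) (fun x => (ops x).E37) := by
  have hfun : (fun x => (ops x).E37) = fun x => E37AllOfOps (W38OfOps (𝔬 x) (rd x) (R x) (H x) (const37 d δ₀ α ρ B₀ Nc N' Cℓ K) ((1 - 2 * α) * δ₀)) (𝔬 x) (R x) (H x) (const37 d δ₀ α ρ B₀ Nc N' Cℓ K) ((1 - 2 * α) * δ₀) (ops x).Gp B₁ δ₁ Bβ Bε Bεβ :=
    funext hE37
  rw [hfun]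
  exact (cor38Printed_E37AllOfOps_iff (fun x => (W38OfOps (𝔬 x) (rd x) (R x) (H x) (const37 d δ₀ α ρ B₀ Nc N' Cℓ K) ((1 - 2 * α) * δ₀))) 𝔬 R H (const37 d δ₀ α ρ B₀ Nc N' Cℓ K) ((1 - 2 * α) * δ₀) (fun x => (ops x).Gp) B₁ δ₁ Bβ Bε Bεβ).mpr
    (cor38Printed_of_local342 𝔬 rd R H κ (const37 d δ₀ α ρ B₀ Nc N' Cℓ K) ((1 - 2 * α) * δ₀) d α ρ Nc N' Cℓ K θ₀ B₀ δ₀ a₁ M₁ ML c35Y_pos hα hα1 hθ₀ hB₀ hδ₀ ha₁ hM₁ hst hκ hrd hloc h261 h36)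

/-! ## `t310` at the all-blocks pin of `E310` -/

/-- ★ **`t310` AT THE ALL-BLOCKS PIN** `(ops x).E310 = W310OfOps (𝔬 x) (rd x) (ConvAll3107 (𝔬 x) (R x) (H x) C δ (ops x).GA B₁ δ₁ …)` (C = `const37 …`, δ = (1−2α)δ₀): n06-k's
inputs give Theorem 3.10 at `W310OfOps … (Conv3107 …)` (`thm310Printed_of_local3107`), and `thm310Printed_allPin_schur` strengthens the predicate from the co-readings of `(ops x).GA`,
the symmetry of G(U) and the transpose pair, `Facts347` for M ≧ M_g, the constants' relations and the residual (3.43)–(3.45) + (3.46)₃,₄,₅ under the provisos — displayed.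
[cite: Balaban1985BackgroundPropagators, Thm 3.10 (3.107)–(3.108) pp.414–416, Thm 3.10 ⇒ Thm 3.3 p.416, (3.42)–(3.47) pp.397–398] -/
theorem t310_of_allPin [∀ x : MemberY θ₃.d₆ θ₃.ℓ₆ θ₃.hd' θ₃.hL' θ₃.b₀ θ₃.b₁ Mstar, Fintype (geo9Y x).Site] [∀ x : MemberY θ₃.d₆ θ₃.ℓ₆ θ₃.hd' θ₃.hL' θ₃.b₀ θ₃.b₁ Mstar, DecidableEq (geo9Y x).Site]
    {X Y ι A : MemberY θ₃.d₆ θ₃.ℓ₆ θ₃.hd' θ₃.hL' θ₃.b₀ θ₃.b₁ Mstar → Type} [∀ x, Fintype (X x)] [∀ x, DecidableEq (X x)] [∀ x, Fintype (Y x)] [∀ x, DecidableEq (Y x)]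
    [∀ x, Fintype (ι x)] [∀ x, Fintype (A x)]
    (𝔬 : ∀ x : MemberY θ₃.d₆ θ₃.ℓ₆ θ₃.hd' θ₃.hL' θ₃.b₀ θ₃.b₁ Mstar, Ops310 (geo9Y x) (bg9Y (Matrix (Fin N) (Fin N) ℂ) (specialUnitaryUnits (Fin N)) x) (X x) (Y x) (ι x) (A x))
    (rd : ∀ x : MemberY θ₃.d₆ θ₃.ℓ₆ θ₃.hd' θ₃.hL' θ₃.b₀ θ₃.b₁ Mstar, WalkReading310 (geo9Y x) (bg9Y (Matrix (Fin N) (Fin N) ℂ) (specialUnitaryUnits (Fin N)) x) (X x) (ι x) (A x))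
    (R : MemberY θ₃.d₆ θ₃.ℓ₆ θ₃.hd' θ₃.hL' θ₃.b₀ θ₃.b₁ Mstar → ℝ) (H : MemberY θ₃.d₆ θ₃.ℓ₆ θ₃.hd' θ₃.hL' θ₃.b₀ θ₃.b₁ Mstar → Prop) (κ : MemberY θ₃.d₆ θ₃.ℓ₆ θ₃.hd' θ₃.hL' θ₃.b₀ θ₃.b₁ Mstar → Sizes310)
    (d : ℕ) (α ρ Nc N' NF Cℓ K θ₀ B₀ δ₀ a₁ M₁ ML : ℝ)
    (hα : 0 ≤ α) (hα2 : α ≤ 1 / 2) (hN : 0 ≤ Nc) (hN' : 0 ≤ N') (hNF : 0 ≤ NF) (hCℓ : 1 ≤ Cℓ) (hK : 0 ≤ K) (hθ₀ : 0 ≤ θ₀) (hB₀ : 0 < B₀)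
    (hδ₀ : 0 < δ₀) (ha₁ : 0 < a₁) (hM₁ : 0 < M₁)
    (hst : ∀ x, StaticOK310 (𝔬 x) ρ Nc N' NF Cℓ (κ x)) (hκ : ∀ x, (κ x).Bounded K)
    (hrd : ∀ x, (rd x).OK (𝔬 x).blk) (hloc : ∀ x, Locality310 (𝔬 x) (rd x))
    (h261 : ∀ x : MemberY θ₃.d₆ θ₃.ℓ₆ θ₃.hd' θ₃.hL' θ₃.b₀ θ₃.b₁ Mstar, ML ≤ (geo9Y x).M → Ineq261 d (toB6 (geo9Y x) (R x) (H x)) δ₀ α)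
    (h36 : ∀ x : MemberY θ₃.d₆ θ₃.ℓ₆ θ₃.hd' θ₃.hL' θ₃.b₀ θ₃.b₁ Mstar, M₁ ≤ (geo9Y x).M → ∀ α₀ : ℝ, 0 < α₀ → c35Y * (geo9Y x).M * α₀ ≤ a₁ →
      ∀ U : (bg9Y (Matrix (Fin N) (Fin N) ℂ) (specialUnitaryUnits (Fin N)) x).Cfg, (bg9Y (Matrix (Fin N) (Fin N) ℂ) (specialUnitaryUnits (Fin N)) x).Reg335 c35Y α₀ U →
        Local342G (𝔬 x) (R x) (H x) B₀ δ₀ U ∧ Factors389 (𝔬 x) (R x) (H x) θ₀ δ₀ U ∧ Identities310 (𝔬 x) (R x) (H x) U)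
    (ev : ∀ x : MemberY θ₃.d₆ θ₃.ℓ₆ θ₃.hd' θ₃.hL' θ₃.b₀ θ₃.b₁ Mstar, (geo9Y x).Loc → X x → ℝ) (evY : ∀ x : MemberY θ₃.d₆ θ₃.ℓ₆ θ₃.hd' θ₃.hL' θ₃.b₀ θ₃.b₁ Mstar, (geo9Y x).Loc → Y x → ℝ)
    (hco0 : ∀ x U, CoRealizes (ops x).GA 0 U (𝔬 x).blk (𝔬 x).blk (ev x) ((𝔬 x).G U))
    (hco1 : ∀ x U, CoRealizes (ops x).GA 1 U (𝔬 x).blkY (𝔬 x).blk (ev x) ((𝔬 x).D U ∘ₗ (𝔬 x).G U))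
    (hco2 : ∀ x U, CoRealizes (ops x).GA 2 U (𝔬 x).blk (𝔬 x).blkY (evY x) ((𝔬 x).G U ∘ₗ (𝔬 x).Dstar U))
    (hco3 : ∀ x U, CoRealizes (ops x).GA 3 U (𝔬 x).blk (𝔬 x).blk (ev x) ((𝔬 x).Lap U ∘ₗ (𝔬 x).G U))
    (hgl0 : ∀ x U, GlobReads (ops x).GA 0 U (𝔬 x).blk (𝔬 x).blk (ev x) ((𝔬 x).G U))
    (hgl1 : ∀ x U, GlobReads (ops x).GA 1 U (𝔬 x).blkY (𝔬 x).blk (ev x) ((𝔬 x).D U ∘ₗ (𝔬 x).G U))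
    (hgl2 : ∀ x U, GlobReads (ops x).GA 2 U (𝔬 x).blk (𝔬 x).blkY (evY x) ((𝔬 x).G U ∘ₗ (𝔬 x).Dstar U))
    (hgl3 : ∀ x U, GlobReads (ops x).GA 3 U (𝔬 x).blk (𝔬 x).blk (ev x) ((𝔬 x).Lap U ∘ₗ (𝔬 x).G U))
    (hl0 : ∀ x U, L2Reads (R := R x) (H := H x) (ops x).GA 0 U (𝔬 x).blk (𝔬 x).blk (ev x) ((𝔬 x).G U))
    (hl1 : ∀ x U, L2Reads (R := R x) (H := H x) (ops x).GA 1 U (𝔬 x).blkY (𝔬 x).blk (ev x) ((𝔬 x).D U ∘ₗ (𝔬 x).G U))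
    (hl2 : ∀ x U, L2Reads (R := R x) (H := H x) (ops x).GA 2 U (𝔬 x).blk (𝔬 x).blkY (evY x) ((𝔬 x).G U ∘ₗ (𝔬 x).Dstar U))
    (hsym : ∀ x U, IsTransposePair ((𝔬 x).G U) ((𝔬 x).G U))
    (htr : ∀ x U, IsTransposePair ((𝔬 x).D U ∘ₗ (𝔬 x).G U) ((𝔬 x).G U ∘ₗ (𝔬 x).Dstar U))
    {dF : ℕ} {αF L₀ B₁ δ₁ Mg Mr ar : ℝ} {Bβ Bε : ℝ → ℝ} {Bεβ : ℝ → ℝ → ℝ}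
    (hfacts : ∀ x : MemberY θ₃.d₆ θ₃.ℓ₆ θ₃.hd' θ₃.hL' θ₃.b₀ θ₃.b₁ Mstar, Mg ≤ (geo9Y x).M → Facts347 (geo9Y x) (R x) (H x) dF ((1 - 2 * α) * δ₀) αF L₀)
    (hCB : (const37 d δ₀ α ρ B₀ Nc N' Cℓ K) ≤ B₁) (hCL : (const37 d δ₀ α ρ B₀ Nc N' Cℓ K) * L₀ ≤ B₁) (hδ₁ : δ₁ ≤ (1 - αF) * ((1 - 2 * α) * δ₀)) (hαF : 0 ≤ αF * ((1 - 2 * α) * δ₀))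
    (hCg : (const37 d δ₀ α ρ B₀ Nc N' Cℓ K) * B6.c1 dF ((1 - 2 * α) * δ₀) (1 - αF) * L₀ ^ (4 : ℝ) ≤ B₁) (har : 0 < ar)
    (hrest : ∀ x : MemberY θ₃.d₆ θ₃.ℓ₆ θ₃.hd' θ₃.hL' θ₃.b₀ θ₃.b₁ Mstar, Mr ≤ (geo9Y x).M → ∀ α₀ : ℝ, 0 < α₀ → (geo9Y x).M * α₀ ≤ ar → ∀ U : (bg9Y (Matrix (Fin N) (Fin N) ℂ) (specialUnitaryUnits (Fin N)) x).Cfg, (bg9Y (Matrix (Fin N) (Fin N) ℂ) (specialUnitaryUnits (Fin N)) x).Reg335 c35Y α₀ U →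
      B9.Ineq343_345 (ops x).GA Bβ Bε Bεβ δ₁ U ∧
        ∀ (n : Fin 6), 3 ≤ n.val → ∀ (lam : (geo9Y x).Loc) (h : (geo9Y x).Cut) (y y' : (geo9Y x).Site), (geo9Y x).cutIn h y →
          (geo9Y x).suppIn lam y' →
          (ops x).GA.l2 n U lam h ≤ B₁ * B9.pref6 ((geo9Y x).len y) n * (geo9Y x).cutSup h * Real.exp (-(δ₁ * (geo9Y x).dist y y')) *
            (geo9Y x).l2Norm lam)
    (hE310 : ∀ x : MemberY θ₃.d₆ θ₃.ℓ₆ θ₃.hd' θ₃.hL' θ₃.b₀ θ₃.b₁ Mstar, (ops x).E310 = W310OfOps (𝔬 x) (rd x) (ConvAll3107 (𝔬 x) (R x) (H x) (const37 d δ₀ α ρ B₀ Nc N' Cℓ K) ((1 - 2 * α) * δ₀) (ops x).GA B₁ δ₁ Bβ Bε Bεβ)) :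
    B9.Thm310Printed c35Y geo9Y (bg9Y (Matrix (Fin N) (Fin N) ℂ) (specialUnitaryUnits (Fin N))) (fun x => (ops x).E310) := by
  have hfun : (fun x => (ops x).E310) = fun x => W310OfOps (𝔬 x) (rd x) (ConvAll3107 (𝔬 x) (R x) (H x) (const37 d δ₀ α ρ B₀ Nc N' Cℓ K) ((1 - 2 * α) * δ₀) (ops x).GA B₁ δ₁ Bβ Bε Bεβ) :=
    funext hE310
  rw [hfun]
  have h310 := thm310Printed_of_local3107 𝔬 rd R H κ d α ρ Nc N' NF Cℓ K θ₀ B₀ δ₀ a₁ M₁ ML c35Y_pos hα hα2 hN hN' hNF hCℓ hK hθ₀ hB₀ hδ₀ ha₁ hM₁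
    hst hκ hrd hloc h261 h36
  exact thm310Printed_allPin_schur (fun x => (ops x).GA) ev evY h310 hco0 hco1 hco2 hco3 hgl0 hgl1 hgl2 hgl3 hl0 hl1 hl2 hsym htr hfacts
    (fun x => geo9Y_dist_comm x) (fun x => geo9K_dist_nonneg x.toKIdx) (fun x => geo9Y_len_pos x) (const37_nonneg d hB₀.le hN hN' hCℓ hK) hCB hCL hδ₁ hαF
    hCg har hrest

/-! ## the whole summation leaf from the two pins -/

/-- ★ **`hsum` FROM THE TWO ALL-BLOCKS PINS ALONE** (pp. 410, 416: «the expansion converges in all norms … all the inequalities (3.42)–(3.47) hold»): with `(ops x).E37` and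
`(ops x).E310` pinned to data whose convergence predicates CONTAIN the typed conclusions of Theorems 3.1 ∕ 3.3 for `(ops x).Gp` ∕ `(ops x).GA`, `B9.RWSumsYieldIneqs` is the projection
(`rwSumsYieldIneqs_allPins`); `0 < B₁`, `0 < δ₁` displayed. [cite: Balaban1985BackgroundPropagators, Thm 3.7 ⇒ Thm 3.1 p.410, Thm 3.10 ⇒ Thm 3.3 p.416] -/
theorem hsum_of_allPins [∀ x : MemberY θ₃.d₆ θ₃.ℓ₆ θ₃.hd' θ₃.hL' θ₃.b₀ θ₃.b₁ Mstar, Fintype (geo9Y x).Site] [∀ x : MemberY θ₃.d₆ θ₃.ℓ₆ θ₃.hd' θ₃.hL' θ₃.b₀ θ₃.b₁ Mstar, DecidableEq (geo9Y x).Site]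
    {X Y ι X3 Y3 ι3 A3 : MemberY θ₃.d₆ θ₃.ℓ₆ θ₃.hd' θ₃.hL' θ₃.b₀ θ₃.b₁ Mstar → Type} [∀ x, Fintype (X x)] [∀ x, DecidableEq (X x)] [∀ x, Fintype (ι x)]
    [∀ x, Fintype (X3 x)] [∀ x, DecidableEq (X3 x)] [∀ x, Fintype (Y3 x)] [∀ x, DecidableEq (Y3 x)] [∀ x, Fintype (ι3 x)] [∀ x, Fintype (A3 x)]
    (𝔬 : ∀ x, Ops (geo9Y x) (bg9Y (Matrix (Fin N) (Fin N) ℂ) (specialUnitaryUnits (Fin N)) x) (X x) (Y x) (ι x)) (rd : ∀ x, WalkReading (geo9Y x) (bg9Y (Matrix (Fin N) (Fin N) ℂ) (specialUnitaryUnits (Fin N)) x) (X x) (ι x))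
    (R : MemberY θ₃.d₆ θ₃.ℓ₆ θ₃.hd' θ₃.hL' θ₃.b₀ θ₃.b₁ Mstar → ℝ) (H : MemberY θ₃.d₆ θ₃.ℓ₆ θ₃.hd' θ₃.hL' θ₃.b₀ θ₃.b₁ Mstar → Prop) (C δ : ℝ)
    (𝔬310 : ∀ x : MemberY θ₃.d₆ θ₃.ℓ₆ θ₃.hd' θ₃.hL' θ₃.b₀ θ₃.b₁ Mstar, Ops310 (geo9Y x) (bg9Y (Matrix (Fin N) (Fin N) ℂ) (specialUnitaryUnits (Fin N)) x) (X3 x) (Y3 x) (ι3 x) (A3 x))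
    (rd310 : ∀ x : MemberY θ₃.d₆ θ₃.ℓ₆ θ₃.hd' θ₃.hL' θ₃.b₀ θ₃.b₁ Mstar, WalkReading310 (geo9Y x) (bg9Y (Matrix (Fin N) (Fin N) ℂ) (specialUnitaryUnits (Fin N)) x) (X3 x) (ι3 x) (A3 x))
    (R3 : MemberY θ₃.d₆ θ₃.ℓ₆ θ₃.hd' θ₃.hL' θ₃.b₀ θ₃.b₁ Mstar → ℝ) (H3 : MemberY θ₃.d₆ θ₃.ℓ₆ θ₃.hd' θ₃.hL' θ₃.b₀ θ₃.b₁ Mstar → Prop) (C3 δ3 : ℝ)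
    {B₁ δ₁ : ℝ} (Bβ Bε : ℝ → ℝ) (Bεβ : ℝ → ℝ → ℝ) (hB₁ : 0 < B₁) (hδ₁ : 0 < δ₁)
    (hE37 : ∀ x : MemberY θ₃.d₆ θ₃.ℓ₆ θ₃.hd' θ₃.hL' θ₃.b₀ θ₃.b₁ Mstar, (ops x).E37 = E37AllOfOps (W38OfOps (𝔬 x) (rd x) (R x) (H x) C δ) (𝔬 x) (R x) (H x) C δ (ops x).Gp B₁ δ₁ Bβ Bε Bεβ)
    (hE310 : ∀ x : MemberY θ₃.d₆ θ₃.ℓ₆ θ₃.hd' θ₃.hL' θ₃.b₀ θ₃.b₁ Mstar, (ops x).E310 = W310OfOps (𝔬310 x) (rd310 x) (ConvAll3107 (𝔬310 x) (R3 x) (H3 x) C3 δ3 (ops x).GA B₁ δ₁ Bβ Bε Bεβ)) :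
    B9.RWSumsYieldIneqs geo9Y (bg9Y (Matrix (Fin N) (Fin N) ℂ) (specialUnitaryUnits (Fin N))) (fun x => (ops x).E37) (fun x => (ops x).E310) (fun x => (ops x).Gp) (fun x => (ops x).GA) := by
  have hf7 : (fun x => (ops x).E37) = fun x => E37AllOfOps (W38OfOps (𝔬 x) (rd x) (R x) (H x) C δ) (𝔬 x) (R x) (H x) C δ (ops x).Gp B₁ δ₁ Bβ Bε Bεβ := funext hE37
  have hf10 : (fun x => (ops x).E310) = fun x => W310OfOps (𝔬310 x) (rd310 x) (ConvAll3107 (𝔬310 x) (R3 x) (H3 x) C3 δ3 (ops x).GA B₁ δ₁ Bβ Bε Bεβ) :=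
    funext hE310
  rw [hf7, hf10]
  exact rwSumsYieldIneqs_allPins (fun x => W38OfOps (𝔬 x) (rd x) (R x) (H x) C δ) 𝔬 R H C δ 𝔬310 rd310 R3 H3 C3 δ3 (fun x => (ops x).Gp)
    (fun x => (ops x).GA) Bβ Bε Bεβ hB₁ hδ₁

end Summit.QuantumFields.YangMills.BalabanUVNodes.N06AtRecord11ObligationsPins4

end
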